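import Mathlib.Tactic
import HarnessLib

/-!
# R-W WINDOW-TABLE, W1 ROWS 1–4 UNCONDITIONAL — the symbolic integer cells (B): the triple `283 + 5¹¹·13² = 2⁸·3⁸·17³` at `l = 19` and `1 + 3¹⁶·7 = 2³·11·23·53³` at `l = 23`

PROOF-ONLY file (D-0012; 0 definitions, 0 `Prop` facts; pure integer arithmetic) of the abc-iut cell — D-0079 RESCUE sub-cell R-W «WINDOW Θ-SIDE
INEQUALITY», W1 ROW DECISIONS composer seat abc-iut-W-row-1 (gen 2). The licence socket's integer cells
`e·⌊(j²P − j·D − (j+1)·ρin)/e⌋ + (j+1)·ρout ≤ P` (`P = e·h/(2l)`, abc-iut-w4-d036's exact cell p460046/p460573 in the orders form of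
`Cor312Prov.licence_settingPrVolSharp_pilotDataOfK_of_orders_rat`) for EVERY admissible ramification index `e = e₀·n`, `n ≥ 1`, at every label
`j = i + 1 ≤ l⋆`, with the one-sided data `D = 2e − 1`, `ρin = e/(p−1)` at the wild primes `3, 5` and `D = e − 1`, `ρin = 1` at the tame poles,
`ρout = min(p^a − a·e, p^b − b·e)` (two envelope members); pattern of abc-iut-w4-d094's `WRow.cell_frey343_three` (floor dropped by
`Int.mul_ediv_self_le`, then `nlinarith`, the no-floor form being linear in `n` at each label). Desk check (session folder work/cells.py): every cell
holds exactly for all `n < 400` and the no-floor form for all `n ≥ 1`. Consumers: the row files `WRowFrey283Unconditional*.lean` /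
`WRowFrey301327048Unconditional.lean`. HONEST SCOPE: integer arithmetic only; nothing here bears on the printed inequality; no abc claim. [folklore]
-/

namespace Summit.ABC.IUTFork.Conditional

/-! ## The cells at `l = 19` and `l = 23` -/

/-- **Cells over `3` for the row `frey283@19`, every `e = 570·n`** (`n ≥ 1`; `P = 240n`, `D = 2e − 1`, `ρin = e/2`,
`ρout = min(3^6 − 6e, 3^7 − 7e)`): the socket's integer cell at every label `j = i + 1 ≤ 9` (floor dropped, linear in `n`). [folklore] -/
theorem WRow.ucell_frey283_l19_p3 {n : ℕ} (hn : 1 ≤ n) (i : ℕ) (hi : i < 9) :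
    ((570 * n : ℕ) : ℤ) *
          (((((i + 1 : ℕ) : ℤ) ^ 2 * ((570 * n * 16 / (2 * 19) : ℕ) : ℤ) - ((i + 1 : ℕ) : ℤ) * ((2 * (570 * n) - 1 : ℕ) : ℤ) -
              ((i + 2 : ℕ) : ℤ) * (((570 * n / 2 : ℕ) : ℤ)))) / ((570 * n : ℕ) : ℤ)) +
        ((i + 2 : ℕ) : ℤ) * min ((3 : ℤ) ^ 6 - 6 * ((570 * n : ℕ) : ℤ)) ((3 : ℤ) ^ 7 - 7 * ((570 * n : ℕ) : ℤ)) ≤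
      ((570 * n * 16 / (2 * 19) : ℕ) : ℤ) := by
  have he0 : (0 : ℤ) < ((570 * n : ℕ) : ℤ) := by positivity
  have hP : (570 * n * 16 / (2 * 19) : ℕ) = 240 * n := by omega
  have hfloor := Int.mul_ediv_self_le (k := ((570 * n : ℕ) : ℤ))
    (x := (((i + 1 : ℕ) : ℤ) ^ 2 * ((570 * n * 16 / (2 * 19) : ℕ) : ℤ) - ((i + 1 : ℕ) : ℤ) * ((2 * (570 * n) - 1 : ℕ) : ℤ) -
              ((i + 2 : ℕ) : ℤ) * (((570 * n / 2 : ℕ) : ℤ)))) he0.ne'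
  have hsub : ((2 * (570 * n) - 1 : ℕ) : ℤ) = 2 * (570 * (n : ℤ)) - 1 := by
    rw [Nat.cast_sub (by omega)]; push_cast; ring
  have hR : (570 * n / 2 : ℕ) = 285 * n := by omega
  rw [hsub, hP, hR] at hfloor ⊢
  have hmin1 : min ((3 : ℤ) ^ 6 - 6 * ((570 * n : ℕ) : ℤ)) ((3 : ℤ) ^ 7 - 7 * ((570 * n : ℕ) : ℤ)) ≤ (729 : ℤ) - 6 * (570 * (n : ℤ)) :=
    (min_le_left _ _).trans (by push_cast; exact le_rfl)
  have hmin2 : min ((3 : ℤ) ^ 6 - 6 * ((570 * n : ℕ) : ℤ)) ((3 : ℤ) ^ 7 - 7 * ((570 * n : ℕ) : ℤ)) ≤ (2187 : ℤ) - 7 * (570 * (n : ℤ)) :=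
    (min_le_right _ _).trans (by push_cast; exact le_rfl)
  generalize min ((3 : ℤ) ^ 6 - 6 * ((570 * n : ℕ) : ℤ)) ((3 : ℤ) ^ 7 - 7 * ((570 * n : ℕ) : ℤ)) = ρ at hmin1 hmin2 ⊢
  interval_cases i <;> push_cast at hfloor ⊢ <;> nlinarith

/-- **Cells over `5` for the row `frey283@19`, every `e = 1140·n`** (`n ≥ 1`; `P = 660n`, `D = 2e − 1`, `ρin = e/4`,
`ρout = min(5^4 − 4e, 5^5 − 5e)`): the socket's integer cell at every label `j = i + 1 ≤ 9` (floor dropped, linear in `n`). [folklore] -/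
theorem WRow.ucell_frey283_l19_p5 {n : ℕ} (hn : 1 ≤ n) (i : ℕ) (hi : i < 9) :
    ((1140 * n : ℕ) : ℤ) *
          (((((i + 1 : ℕ) : ℤ) ^ 2 * ((1140 * n * 22 / (2 * 19) : ℕ) : ℤ) - ((i + 1 : ℕ) : ℤ) * ((2 * (1140 * n) - 1 : ℕ) : ℤ) -
              ((i + 2 : ℕ) : ℤ) * (((1140 * n / 4 : ℕ) : ℤ)))) / ((1140 * n : ℕ) : ℤ)) +
        ((i + 2 : ℕ) : ℤ) * min ((5 : ℤ) ^ 4 - 4 * ((1140 * n : ℕ) : ℤ)) ((5 : ℤ) ^ 5 - 5 * ((1140 * n : ℕ) : ℤ)) ≤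
      ((1140 * n * 22 / (2 * 19) : ℕ) : ℤ) := by
  have he0 : (0 : ℤ) < ((1140 * n : ℕ) : ℤ) := by positivity
  have hP : (1140 * n * 22 / (2 * 19) : ℕ) = 660 * n := by omega
  have hfloor := Int.mul_ediv_self_le (k := ((1140 * n : ℕ) : ℤ))
    (x := (((i + 1 : ℕ) : ℤ) ^ 2 * ((1140 * n * 22 / (2 * 19) : ℕ) : ℤ) - ((i + 1 : ℕ) : ℤ) * ((2 * (1140 * n) - 1 : ℕ) : ℤ) -
              ((i + 2 : ℕ) : ℤ) * (((1140 * n / 4 : ℕ) : ℤ)))) he0.ne'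
  have hsub : ((2 * (1140 * n) - 1 : ℕ) : ℤ) = 2 * (1140 * (n : ℤ)) - 1 := by
    rw [Nat.cast_sub (by omega)]; push_cast; ring
  have hR : (1140 * n / 4 : ℕ) = 285 * n := by omega
  rw [hsub, hP, hR] at hfloor ⊢
  have hmin1 : min ((5 : ℤ) ^ 4 - 4 * ((1140 * n : ℕ) : ℤ)) ((5 : ℤ) ^ 5 - 5 * ((1140 * n : ℕ) : ℤ)) ≤ (625 : ℤ) - 4 * (1140 * (n : ℤ)) :=
    (min_le_left _ _).trans (by push_cast; exact le_rfl)
  have hmin2 : min ((5 : ℤ) ^ 4 - 4 * ((1140 * n : ℕ) : ℤ)) ((5 : ℤ) ^ 5 - 5 * ((1140 * n : ℕ) : ℤ)) ≤ (3125 : ℤ) - 5 * (1140 * (n : ℤ)) :=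
    (min_le_right _ _).trans (by push_cast; exact le_rfl)
  generalize min ((5 : ℤ) ^ 4 - 4 * ((1140 * n : ℕ) : ℤ)) ((5 : ℤ) ^ 5 - 5 * ((1140 * n : ℕ) : ℤ)) = ρ at hmin1 hmin2 ⊢
  interval_cases i <;> push_cast at hfloor ⊢ <;> nlinarith

/-- **Cells over `13` for the row `frey283@19`, every `e = 285·n`** (`n ≥ 1`; `P = 30n`, `D = e − 1`, `ρin = 1`,
`ρout = min(13^2 − 2e, 13^3 − 3e)`): the socket's integer cell at every label `j = i + 1 ≤ 9` (floor dropped, linear in `n`). [folklore] -/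
theorem WRow.ucell_frey283_l19_p13 {n : ℕ} (hn : 1 ≤ n) (i : ℕ) (hi : i < 9) :
    ((285 * n : ℕ) : ℤ) *
          (((((i + 1 : ℕ) : ℤ) ^ 2 * ((285 * n * 4 / (2 * 19) : ℕ) : ℤ) - ((i + 1 : ℕ) : ℤ) * ((285 * n - 1 : ℕ) : ℤ) -
              ((i + 2 : ℕ) : ℤ) * (1 : ℤ))) / ((285 * n : ℕ) : ℤ)) +
        ((i + 2 : ℕ) : ℤ) * min ((13 : ℤ) ^ 2 - 2 * ((285 * n : ℕ) : ℤ)) ((13 : ℤ) ^ 3 - 3 * ((285 * n : ℕ) : ℤ)) ≤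
      ((285 * n * 4 / (2 * 19) : ℕ) : ℤ) := by
  have he0 : (0 : ℤ) < ((285 * n : ℕ) : ℤ) := by positivity
  have hP : (285 * n * 4 / (2 * 19) : ℕ) = 30 * n := by omega
  have hfloor := Int.mul_ediv_self_le (k := ((285 * n : ℕ) : ℤ))
    (x := (((i + 1 : ℕ) : ℤ) ^ 2 * ((285 * n * 4 / (2 * 19) : ℕ) : ℤ) - ((i + 1 : ℕ) : ℤ) * ((285 * n - 1 : ℕ) : ℤ) -
              ((i + 2 : ℕ) : ℤ) * (1 : ℤ))) he0.ne'
  have hsub : ((285 * n - 1 : ℕ) : ℤ) = 285 * (n : ℤ) - 1 := by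
    rw [Nat.cast_sub (by omega)]; push_cast; ring
  rw [hsub, hP] at hfloor ⊢
  have hmin1 : min ((13 : ℤ) ^ 2 - 2 * ((285 * n : ℕ) : ℤ)) ((13 : ℤ) ^ 3 - 3 * ((285 * n : ℕ) : ℤ)) ≤ (169 : ℤ) - 2 * (285 * (n : ℤ)) :=
    (min_le_left _ _).trans (by push_cast; exact le_rfl)
  have hmin2 : min ((13 : ℤ) ^ 2 - 2 * ((285 * n : ℕ) : ℤ)) ((13 : ℤ) ^ 3 - 3 * ((285 * n : ℕ) : ℤ)) ≤ (2197 : ℤ) - 3 * (285 * (n : ℤ)) :=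
    (min_le_right _ _).trans (by push_cast; exact le_rfl)
  generalize min ((13 : ℤ) ^ 2 - 2 * ((285 * n : ℕ) : ℤ)) ((13 : ℤ) ^ 3 - 3 * ((285 * n : ℕ) : ℤ)) = ρ at hmin1 hmin2 ⊢
  interval_cases i <;> push_cast at hfloor ⊢ <;> nlinarith

/-- **Cells over `17` for the row `frey283@19`, every `e = 95·n`** (`n ≥ 1`; `P = 15n`, `D = e − 1`, `ρin = 1`,
`ρout = min(17^1 − 1e, 17^2 − 2e)`): the socket's integer cell at every label `j = i + 1 ≤ 9` (floor dropped, linear in `n`). [folklore] -/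
theorem WRow.ucell_frey283_l19_p17 {n : ℕ} (hn : 1 ≤ n) (i : ℕ) (hi : i < 9) :
    ((95 * n : ℕ) : ℤ) *
          (((((i + 1 : ℕ) : ℤ) ^ 2 * ((95 * n * 6 / (2 * 19) : ℕ) : ℤ) - ((i + 1 : ℕ) : ℤ) * ((95 * n - 1 : ℕ) : ℤ) -
              ((i + 2 : ℕ) : ℤ) * (1 : ℤ))) / ((95 * n : ℕ) : ℤ)) +
        ((i + 2 : ℕ) : ℤ) * min ((17 : ℤ) ^ 1 - 1 * ((95 * n : ℕ) : ℤ)) ((17 : ℤ) ^ 2 - 2 * ((95 * n : ℕ) : ℤ)) ≤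
      ((95 * n * 6 / (2 * 19) : ℕ) : ℤ) := by
  have he0 : (0 : ℤ) < ((95 * n : ℕ) : ℤ) := by positivity
  have hP : (95 * n * 6 / (2 * 19) : ℕ) = 15 * n := by omega
  have hfloor := Int.mul_ediv_self_le (k := ((95 * n : ℕ) : ℤ))
    (x := (((i + 1 : ℕ) : ℤ) ^ 2 * ((95 * n * 6 / (2 * 19) : ℕ) : ℤ) - ((i + 1 : ℕ) : ℤ) * ((95 * n - 1 : ℕ) : ℤ) -
              ((i + 2 : ℕ) : ℤ) * (1 : ℤ))) he0.ne'
  have hsub : ((95 * n - 1 : ℕ) : ℤ) = 95 * (n : ℤ) - 1 := by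
    rw [Nat.cast_sub (by omega)]; push_cast; ring
  rw [hsub, hP] at hfloor ⊢
  have hmin1 : min ((17 : ℤ) ^ 1 - 1 * ((95 * n : ℕ) : ℤ)) ((17 : ℤ) ^ 2 - 2 * ((95 * n : ℕ) : ℤ)) ≤ (17 : ℤ) - 1 * (95 * (n : ℤ)) :=
    (min_le_left _ _).trans (by push_cast; exact le_rfl)
  have hmin2 : min ((17 : ℤ) ^ 1 - 1 * ((95 * n : ℕ) : ℤ)) ((17 : ℤ) ^ 2 - 2 * ((95 * n : ℕ) : ℤ)) ≤ (289 : ℤ) - 2 * (95 * (n : ℤ)) :=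
    (min_le_right _ _).trans (by push_cast; exact le_rfl)
  generalize min ((17 : ℤ) ^ 1 - 1 * ((95 * n : ℕ) : ℤ)) ((17 : ℤ) ^ 2 - 2 * ((95 * n : ℕ) : ℤ)) = ρ at hmin1 hmin2 ⊢
  interval_cases i <;> push_cast at hfloor ⊢ <;> nlinarith

/-- **Cells over `283` for the row `frey283@19`, every `e = 285·n`** (`n ≥ 1`; `P = 15n`, `D = e − 1`, `ρin = 1`,
`ρout = min(283^1 − 1e, 283^2 − 2e)`): the socket's integer cell at every label `j = i + 1 ≤ 9` (floor dropped, linear in `n`). [folklore] -/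
theorem WRow.ucell_frey283_l19_p283 {n : ℕ} (hn : 1 ≤ n) (i : ℕ) (hi : i < 9) :
    ((285 * n : ℕ) : ℤ) *
          (((((i + 1 : ℕ) : ℤ) ^ 2 * ((285 * n * 2 / (2 * 19) : ℕ) : ℤ) - ((i + 1 : ℕ) : ℤ) * ((285 * n - 1 : ℕ) : ℤ) -
              ((i + 2 : ℕ) : ℤ) * (1 : ℤ))) / ((285 * n : ℕ) : ℤ)) +
        ((i + 2 : ℕ) : ℤ) * min ((283 : ℤ) ^ 1 - 1 * ((285 * n : ℕ) : ℤ)) ((283 : ℤ) ^ 2 - 2 * ((285 * n : ℕ) : ℤ)) ≤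
      ((285 * n * 2 / (2 * 19) : ℕ) : ℤ) := by
  have he0 : (0 : ℤ) < ((285 * n : ℕ) : ℤ) := by positivity
  have hP : (285 * n * 2 / (2 * 19) : ℕ) = 15 * n := by omega
  have hfloor := Int.mul_ediv_self_le (k := ((285 * n : ℕ) : ℤ))
    (x := (((i + 1 : ℕ) : ℤ) ^ 2 * ((285 * n * 2 / (2 * 19) : ℕ) : ℤ) - ((i + 1 : ℕ) : ℤ) * ((285 * n - 1 : ℕ) : ℤ) -
              ((i + 2 : ℕ) : ℤ) * (1 : ℤ))) he0.ne'
  have hsub : ((285 * n - 1 : ℕ) : ℤ) = 285 * (n : ℤ) - 1 := by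
    rw [Nat.cast_sub (by omega)]; push_cast; ring
  rw [hsub, hP] at hfloor ⊢
  have hmin1 : min ((283 : ℤ) ^ 1 - 1 * ((285 * n : ℕ) : ℤ)) ((283 : ℤ) ^ 2 - 2 * ((285 * n : ℕ) : ℤ)) ≤ (283 : ℤ) - 1 * (285 * (n : ℤ)) :=
    (min_le_left _ _).trans (by push_cast; exact le_rfl)
  have hmin2 : min ((283 : ℤ) ^ 1 - 1 * ((285 * n : ℕ) : ℤ)) ((283 : ℤ) ^ 2 - 2 * ((285 * n : ℕ) : ℤ)) ≤ (80089 : ℤ) - 2 * (285 * (n : ℤ)) :=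
    (min_le_right _ _).trans (by push_cast; exact le_rfl)
  generalize min ((283 : ℤ) ^ 1 - 1 * ((285 * n : ℕ) : ℤ)) ((283 : ℤ) ^ 2 - 2 * ((285 * n : ℕ) : ℤ)) = ρ at hmin1 hmin2 ⊢
  interval_cases i <;> push_cast at hfloor ⊢ <;> nlinarith

/-- **Cells over `3` for the row `frey301327048@23`, every `e = 690·n`** (`n ≥ 1`; `P = 480n`, `D = 2e − 1`, `ρin = e/2`,
`ρout = min(3^6 − 6e, 3^7 − 7e)`): the socket's integer cell at every label `j = i + 1 ≤ 11` (floor dropped, linear in `n`). [folklore] -/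
theorem WRow.ucell_frey301327048_l23_p3 {n : ℕ} (hn : 1 ≤ n) (i : ℕ) (hi : i < 11) :
    ((690 * n : ℕ) : ℤ) *
          (((((i + 1 : ℕ) : ℤ) ^ 2 * ((690 * n * 32 / (2 * 23) : ℕ) : ℤ) - ((i + 1 : ℕ) : ℤ) * ((2 * (690 * n) - 1 : ℕ) : ℤ) -
              ((i + 2 : ℕ) : ℤ) * (((690 * n / 2 : ℕ) : ℤ)))) / ((690 * n : ℕ) : ℤ)) +
        ((i + 2 : ℕ) : ℤ) * min ((3 : ℤ) ^ 6 - 6 * ((690 * n : ℕ) : ℤ)) ((3 : ℤ) ^ 7 - 7 * ((690 * n : ℕ) : ℤ)) ≤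
      ((690 * n * 32 / (2 * 23) : ℕ) : ℤ) := by
  have he0 : (0 : ℤ) < ((690 * n : ℕ) : ℤ) := by positivity
  have hP : (690 * n * 32 / (2 * 23) : ℕ) = 480 * n := by omega
  have hfloor := Int.mul_ediv_self_le (k := ((690 * n : ℕ) : ℤ))
    (x := (((i + 1 : ℕ) : ℤ) ^ 2 * ((690 * n * 32 / (2 * 23) : ℕ) : ℤ) - ((i + 1 : ℕ) : ℤ) * ((2 * (690 * n) - 1 : ℕ) : ℤ) -
              ((i + 2 : ℕ) : ℤ) * (((690 * n / 2 : ℕ) : ℤ)))) he0.ne'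
  have hsub : ((2 * (690 * n) - 1 : ℕ) : ℤ) = 2 * (690 * (n : ℤ)) - 1 := by
    rw [Nat.cast_sub (by omega)]; push_cast; ring
  have hR : (690 * n / 2 : ℕ) = 345 * n := by omega
  rw [hsub, hP, hR] at hfloor ⊢
  have hmin1 : min ((3 : ℤ) ^ 6 - 6 * ((690 * n : ℕ) : ℤ)) ((3 : ℤ) ^ 7 - 7 * ((690 * n : ℕ) : ℤ)) ≤ (729 : ℤ) - 6 * (690 * (n : ℤ)) :=
    (min_le_left _ _).trans (by push_cast; exact le_rfl)
  have hmin2 : min ((3 : ℤ) ^ 6 - 6 * ((690 * n : ℕ) : ℤ)) ((3 : ℤ) ^ 7 - 7 * ((690 * n : ℕ) : ℤ)) ≤ (2187 : ℤ) - 7 * (690 * (n : ℤ)) :=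
    (min_le_right _ _).trans (by push_cast; exact le_rfl)
  generalize min ((3 : ℤ) ^ 6 - 6 * ((690 * n : ℕ) : ℤ)) ((3 : ℤ) ^ 7 - 7 * ((690 * n : ℕ) : ℤ)) = ρ at hmin1 hmin2 ⊢
  interval_cases i <;> push_cast at hfloor ⊢ <;> nlinarith

/-- **Cells over `7` for the row `frey301327048@23`, every `e = 345·n`** (`n ≥ 1`; `P = 15n`, `D = e − 1`, `ρin = 1`,
`ρout = min(7^3 − 3e, 7^4 − 4e)`): the socket's integer cell at every label `j = i + 1 ≤ 11` (floor dropped, linear in `n`). [folklore] -/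
theorem WRow.ucell_frey301327048_l23_p7 {n : ℕ} (hn : 1 ≤ n) (i : ℕ) (hi : i < 11) :
    ((345 * n : ℕ) : ℤ) *
          (((((i + 1 : ℕ) : ℤ) ^ 2 * ((345 * n * 2 / (2 * 23) : ℕ) : ℤ) - ((i + 1 : ℕ) : ℤ) * ((345 * n - 1 : ℕ) : ℤ) -
              ((i + 2 : ℕ) : ℤ) * (1 : ℤ))) / ((345 * n : ℕ) : ℤ)) +
        ((i + 2 : ℕ) : ℤ) * min ((7 : ℤ) ^ 3 - 3 * ((345 * n : ℕ) : ℤ)) ((7 : ℤ) ^ 4 - 4 * ((345 * n : ℕ) : ℤ)) ≤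
      ((345 * n * 2 / (2 * 23) : ℕ) : ℤ) := by
  have he0 : (0 : ℤ) < ((345 * n : ℕ) : ℤ) := by positivity
  have hP : (345 * n * 2 / (2 * 23) : ℕ) = 15 * n := by omega
  have hfloor := Int.mul_ediv_self_le (k := ((345 * n : ℕ) : ℤ))
    (x := (((i + 1 : ℕ) : ℤ) ^ 2 * ((345 * n * 2 / (2 * 23) : ℕ) : ℤ) - ((i + 1 : ℕ) : ℤ) * ((345 * n - 1 : ℕ) : ℤ) -
              ((i + 2 : ℕ) : ℤ) * (1 : ℤ))) he0.ne'
  have hsub : ((345 * n - 1 : ℕ) : ℤ) = 345 * (n : ℤ) - 1 := by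
    rw [Nat.cast_sub (by omega)]; push_cast; ring
  rw [hsub, hP] at hfloor ⊢
  have hmin1 : min ((7 : ℤ) ^ 3 - 3 * ((345 * n : ℕ) : ℤ)) ((7 : ℤ) ^ 4 - 4 * ((345 * n : ℕ) : ℤ)) ≤ (343 : ℤ) - 3 * (345 * (n : ℤ)) :=
    (min_le_left _ _).trans (by push_cast; exact le_rfl)
  have hmin2 : min ((7 : ℤ) ^ 3 - 3 * ((345 * n : ℕ) : ℤ)) ((7 : ℤ) ^ 4 - 4 * ((345 * n : ℕ) : ℤ)) ≤ (2401 : ℤ) - 4 * (345 * (n : ℤ)) :=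
    (min_le_right _ _).trans (by push_cast; exact le_rfl)
  generalize min ((7 : ℤ) ^ 3 - 3 * ((345 * n : ℕ) : ℤ)) ((7 : ℤ) ^ 4 - 4 * ((345 * n : ℕ) : ℤ)) = ρ at hmin1 hmin2 ⊢
  interval_cases i <;> push_cast at hfloor ⊢ <;> nlinarith

/-- **Cells over `11` for the row `frey301327048@23`, every `e = 345·n`** (`n ≥ 1`; `P = 15n`, `D = e − 1`, `ρin = 1`,
`ρout = min(11^2 − 2e, 11^3 − 3e)`): the socket's integer cell at every label `j = i + 1 ≤ 11` (floor dropped, linear in `n`). [folklore] -/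
theorem WRow.ucell_frey301327048_l23_p11 {n : ℕ} (hn : 1 ≤ n) (i : ℕ) (hi : i < 11) :
    ((345 * n : ℕ) : ℤ) *
          (((((i + 1 : ℕ) : ℤ) ^ 2 * ((345 * n * 2 / (2 * 23) : ℕ) : ℤ) - ((i + 1 : ℕ) : ℤ) * ((345 * n - 1 : ℕ) : ℤ) -
              ((i + 2 : ℕ) : ℤ) * (1 : ℤ))) / ((345 * n : ℕ) : ℤ)) +
        ((i + 2 : ℕ) : ℤ) * min ((11 : ℤ) ^ 2 - 2 * ((345 * n : ℕ) : ℤ)) ((11 : ℤ) ^ 3 - 3 * ((345 * n : ℕ) : ℤ)) ≤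
      ((345 * n * 2 / (2 * 23) : ℕ) : ℤ) := by
  have he0 : (0 : ℤ) < ((345 * n : ℕ) : ℤ) := by positivity
  have hP : (345 * n * 2 / (2 * 23) : ℕ) = 15 * n := by omega
  have hfloor := Int.mul_ediv_self_le (k := ((345 * n : ℕ) : ℤ))
    (x := (((i + 1 : ℕ) : ℤ) ^ 2 * ((345 * n * 2 / (2 * 23) : ℕ) : ℤ) - ((i + 1 : ℕ) : ℤ) * ((345 * n - 1 : ℕ) : ℤ) -
              ((i + 2 : ℕ) : ℤ) * (1 : ℤ))) he0.ne'
  have hsub : ((345 * n - 1 : ℕ) : ℤ) = 345 * (n : ℤ) - 1 := by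
    rw [Nat.cast_sub (by omega)]; push_cast; ring
  rw [hsub, hP] at hfloor ⊢
  have hmin1 : min ((11 : ℤ) ^ 2 - 2 * ((345 * n : ℕ) : ℤ)) ((11 : ℤ) ^ 3 - 3 * ((345 * n : ℕ) : ℤ)) ≤ (121 : ℤ) - 2 * (345 * (n : ℤ)) :=
    (min_le_left _ _).trans (by push_cast; exact le_rfl)
  have hmin2 : min ((11 : ℤ) ^ 2 - 2 * ((345 * n : ℕ) : ℤ)) ((11 : ℤ) ^ 3 - 3 * ((345 * n : ℕ) : ℤ)) ≤ (1331 : ℤ) - 3 * (345 * (n : ℤ)) :=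
    (min_le_right _ _).trans (by push_cast; exact le_rfl)
  generalize min ((11 : ℤ) ^ 2 - 2 * ((345 * n : ℕ) : ℤ)) ((11 : ℤ) ^ 3 - 3 * ((345 * n : ℕ) : ℤ)) = ρ at hmin1 hmin2 ⊢
  interval_cases i <;> push_cast at hfloor ⊢ <;> nlinarith

/-- **Cells over `53` for the row `frey301327048@23`, every `e = 115·n`** (`n ≥ 1`; `P = 15n`, `D = e − 1`, `ρin = 1`,
`ρout = min(53^1 − 1e, 53^2 − 2e)`): the socket's integer cell at every label `j = i + 1 ≤ 11` (floor dropped, linear in `n`). [folklore] -/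
theorem WRow.ucell_frey301327048_l23_p53 {n : ℕ} (hn : 1 ≤ n) (i : ℕ) (hi : i < 11) :
    ((115 * n : ℕ) : ℤ) *
          (((((i + 1 : ℕ) : ℤ) ^ 2 * ((115 * n * 6 / (2 * 23) : ℕ) : ℤ) - ((i + 1 : ℕ) : ℤ) * ((115 * n - 1 : ℕ) : ℤ) -
              ((i + 2 : ℕ) : ℤ) * (1 : ℤ))) / ((115 * n : ℕ) : ℤ)) +
        ((i + 2 : ℕ) : ℤ) * min ((53 : ℤ) ^ 1 - 1 * ((115 * n : ℕ) : ℤ)) ((53 : ℤ) ^ 2 - 2 * ((115 * n : ℕ) : ℤ)) ≤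
      ((115 * n * 6 / (2 * 23) : ℕ) : ℤ) := by
  have he0 : (0 : ℤ) < ((115 * n : ℕ) : ℤ) := by positivity
  have hP : (115 * n * 6 / (2 * 23) : ℕ) = 15 * n := by omega
  have hfloor := Int.mul_ediv_self_le (k := ((115 * n : ℕ) : ℤ))
    (x := (((i + 1 : ℕ) : ℤ) ^ 2 * ((115 * n * 6 / (2 * 23) : ℕ) : ℤ) - ((i + 1 : ℕ) : ℤ) * ((115 * n - 1 : ℕ) : ℤ) -
              ((i + 2 : ℕ) : ℤ) * (1 : ℤ))) he0.ne'
  have hsub : ((115 * n - 1 : ℕ) : ℤ) = 115 * (n : ℤ) - 1 := by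
    rw [Nat.cast_sub (by omega)]; push_cast; ring
  rw [hsub, hP] at hfloor ⊢
  have hmin1 : min ((53 : ℤ) ^ 1 - 1 * ((115 * n : ℕ) : ℤ)) ((53 : ℤ) ^ 2 - 2 * ((115 * n : ℕ) : ℤ)) ≤ (53 : ℤ) - 1 * (115 * (n : ℤ)) :=
    (min_le_left _ _).trans (by push_cast; exact le_rfl)
  have hmin2 : min ((53 : ℤ) ^ 1 - 1 * ((115 * n : ℕ) : ℤ)) ((53 : ℤ) ^ 2 - 2 * ((115 * n : ℕ) : ℤ)) ≤ (2809 : ℤ) - 2 * (115 * (n : ℤ)) :=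
    (min_le_right _ _).trans (by push_cast; exact le_rfl)
  generalize min ((53 : ℤ) ^ 1 - 1 * ((115 * n : ℕ) : ℤ)) ((53 : ℤ) ^ 2 - 2 * ((115 * n : ℕ) : ℤ)) = ρ at hmin1 hmin2 ⊢
  interval_cases i <;> push_cast at hfloor ⊢ <;> nlinarith

end Summit.ABC.IUTFork.Conditional
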